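import Literature.Analysis.FunctionSpaces.TorusFluidGlueProofs
import Literature.Analysis.FunctionSpaces.TorusLinearisedNSEnergy
import Literature.Analysis.FunctionSpaces.TorusTrilinearH1
import Literature.Analysis.FunctionSpaces.TorusClassicalNSUniqueness
import Literature.Analysis.FunctionSpaces.TorusCalculusProofs
import Literature.Analysis.FunctionSpaces.LadyzhenskayaTorus
import HarnessLib

/-!
# Stub `stub_residualPerturbation` of the line `birth`
# (crux stmt-AnomalousDissipation-16294, `NeutralTaylorWaves.NonresonantSelection`)

Perturbation of the bordered residual of the steady Navier–Stokes operator on `T³`, linearised at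
a base `(w, c)` (drift `c` along `x₃`), under a `δ`-perturbation of the base.  For smooth
`w₁, w, v : T³ → ℝ³`, smooth `r : T³ → ℝ`, reals `ν, c₁, c, b` and `δ ≥ 0` with
`sup ‖w − w₁‖ ≤ δ`, `sup ‖∂ᵢw − ∂ᵢw₁‖ ≤ δ` and `|c − c₁| ≤ δ`, the bordered residuals
`F₁ = (w₁·∇)v + (v·∇)w₁ − νΔv + ∇r − c₁∂₃v − b∂₃w₁` and
`F = (w·∇)v + (v·∇)w − νΔv + ∇r − c∂₃v − b∂₃w` of the same test triple `(v, r, b)` satisfy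
`‖F₁‖₂ ≤ ‖F‖₂ + δ (2‖∇v‖₂ + 2‖v‖₂ + |b|)` (`‖∇v‖₂² = Torus.gradNormSq v`), and the border
pairings satisfy `|∫⟪v, ∂₃w₁⟫ − ∫⟪v, ∂₃w⟫| ≤ δ ‖v‖₂`.

Proof (elementary): pointwise
`F₁ − F = Dv[w₁ − w] + ∑ᵢ vᵢ (∂ᵢw₁ − ∂ᵢw) + (c − c₁) ∂₃v + b (∂₃w − ∂₃w₁)`
(`(u·∇)v = Dv[u] = ∑ᵢ uᵢ ∂ᵢv`, `Torus.fderiv_apply_eq_sum_partialDeriv`), with the pointwise bounds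
`‖Dv(x) e‖ ≤ ‖e‖ (∑ᵢ ‖∂ᵢv(x)‖²)^{1/2}`, `‖∑ᵢ vᵢ eᵢ‖ ≤ (∑ᵢ |vᵢ|) maxᵢ ‖eᵢ‖ ≤ 2‖v‖ maxᵢ ‖eᵢ‖`
(Cauchy–Schwarz in `ℝ³` and `√3 ≤ 2`), `‖∂₃v‖² ≤ ∑ᵢ ‖∂ᵢv‖²`; then Minkowski in `L²(T³)`
(`Torus.sqrt_integral_norm_add_sq_le`) and, for the pairings, Cauchy–Schwarz in `L²(T³)`
(`Torus.integral_mul_le_sqrt_mul_sqrt_of_continuous`) on the probability space `T³`.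

No definitions; helper lemmas are prefixed `nonresonantSelection_perturb_`.  The last theorem is the
registered stub signature verbatim.
-/

-- `Summit.<Summit>.<Problem>` is the tree's mandated summit-side namespace (CONVENTIONS §2); for this
-- single-conjunct summit the two coincide, so the duplicate is deliberate.
set_option linter.dupNamespace false

noncomputable section

namespace Summit.AnomalousDissipation.AnomalousDissipation.Theorems

open MeasureTheory
open scoped InnerProductSpace
open Literature.Analysis.FunctionSpaces

/-! ## Pointwise linear algebra in `ℝ³` -/

/-- `∑ᵢ |eᵢ| ≤ 2 ‖e‖` for `e ∈ ℝ³` (Cauchy–Schwarz gives `√3 ‖e‖`, and `√3 ≤ 2`). [folklore] -/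
theorem nonresonantSelection_perturb_sum_abs_le (e : EuclideanSpace ℝ (Fin 3)) :
    ∑ i, |e i| ≤ 2 * ‖e‖ := by
  have hCS := Real.sum_mul_le_sqrt_mul_sqrt Finset.univ (fun i => |e i|) (fun _ : Fin 3 => (1 : ℝ))
  have hn : Real.sqrt (∑ i, |e i| ^ 2) = ‖e‖ := by
    rw [EuclideanSpace.norm_eq]
    simp only [Real.norm_eq_abs]
  have h3 : Real.sqrt (∑ _i : Fin 3, (1 : ℝ) ^ 2) ≤ 2 := by
    rw [Real.sqrt_le_left (by norm_num : (0 : ℝ) ≤ 2)]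
    norm_num
  calc ∑ i, |e i| = ∑ i, |e i| * 1 := by simp only [mul_one]
    _ ≤ Real.sqrt (∑ i, |e i| ^ 2) * Real.sqrt (∑ _i : Fin 3, (1 : ℝ) ^ 2) := hCS
    _ ≤ ‖e‖ * 2 := by
        rw [hn]
        exact mul_le_mul_of_nonneg_left h3 (norm_nonneg _)
    _ = 2 * ‖e‖ := mul_comm _ _

/-- `‖Df(x) e‖ ≤ ‖e‖ (∑ᵢ ‖∂ᵢf(x)‖²)^{1/2}` for a smooth field `f` on `T³` and `e ∈ ℝ³`
(`Df(x) e = ∑ᵢ eᵢ ∂ᵢf(x)` and Cauchy–Schwarz in `ℝ³`). [folklore] -/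
theorem nonresonantSelection_perturb_norm_fderiv_apply_le
    {f : UnitAddTorus (Fin 3) → EuclideanSpace ℝ (Fin 3)} (hf : Torus.IsSmooth f)
    (x : UnitAddTorus (Fin 3)) (e : EuclideanSpace ℝ (Fin 3)) :
    ‖Torus.fderiv f x e‖ ≤ ‖e‖ * Real.sqrt (∑ i, ‖Torus.partialDeriv i f x‖ ^ 2) := by
  rw [Torus.fderiv_apply_eq_sum_partialDeriv (hf.isContDiff (by simp)) x e]
  have hn : Real.sqrt (∑ i, |e i| ^ 2) = ‖e‖ := by
    rw [EuclideanSpace.norm_eq]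
    simp only [Real.norm_eq_abs]
  calc ‖∑ i, e i • Torus.partialDeriv i f x‖ ≤ ∑ i, ‖e i • Torus.partialDeriv i f x‖ :=
        norm_sum_le _ _
    _ = ∑ i, |e i| * ‖Torus.partialDeriv i f x‖ := by simp only [norm_smul, Real.norm_eq_abs]
    _ ≤ Real.sqrt (∑ i, |e i| ^ 2) * Real.sqrt (∑ i, ‖Torus.partialDeriv i f x‖ ^ 2) :=
        Real.sum_mul_le_sqrt_mul_sqrt _ _ _
    _ = ‖e‖ * Real.sqrt (∑ i, ‖Torus.partialDeriv i f x‖ ^ 2) := by rw [hn]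

/-- `‖∑ᵢ eᵢ • gᵢ‖ ≤ 2 δ ‖e‖` for `e ∈ ℝ³` and vectors `g₁, g₂, g₃` with `‖gᵢ‖ ≤ δ`. [folklore] -/
theorem nonresonantSelection_perturb_norm_sum_smul_le {G : Type*} [NormedAddCommGroup G]
    [NormedSpace ℝ G] (e : EuclideanSpace ℝ (Fin 3)) (g : Fin 3 → G) {δ : ℝ} (hδ : 0 ≤ δ)
    (hg : ∀ i, ‖g i‖ ≤ δ) : ‖∑ i, e i • g i‖ ≤ 2 * δ * ‖e‖ := by
  calc ‖∑ i, e i • g i‖ ≤ ∑ i, ‖e i • g i‖ := norm_sum_le _ _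
    _ = ∑ i, |e i| * ‖g i‖ := by simp only [norm_smul, Real.norm_eq_abs]
    _ ≤ ∑ i, |e i| * δ :=
        Finset.sum_le_sum fun i _ => mul_le_mul_of_nonneg_left (hg i) (abs_nonneg _)
    _ = δ * ∑ i, |e i| := by rw [← Finset.sum_mul, mul_comm]
    _ ≤ δ * (2 * ‖e‖) := mul_le_mul_of_nonneg_left (nonresonantSelection_perturb_sum_abs_le e) hδ
    _ = 2 * δ * ‖e‖ := by ring

/-! ## `L²(T³)` bookkeeping -/

/-- From a pointwise bound `‖g‖² ≤ K² h` (continuous `g`, `h`, `K ≥ 0`) to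
`(∫ ‖g‖²)^{1/2} ≤ K (∫ h)^{1/2}` on `T³`. [folklore] -/
theorem nonresonantSelection_perturb_sqrt_integral_le {G : Type*} [NormedAddCommGroup G]
    {g : UnitAddTorus (Fin 3) → G} {h : UnitAddTorus (Fin 3) → ℝ} (hg : Continuous g)
    (hh : Continuous h) {K : ℝ} (hK : 0 ≤ K) (hle : ∀ x, ‖g x‖ ^ 2 ≤ K ^ 2 * h x) :
    Real.sqrt (∫ x, ‖g x‖ ^ 2) ≤ K * Real.sqrt (∫ x, h x) := by
  have h1 : ∫ x, ‖g x‖ ^ 2 ≤ K ^ 2 * ∫ x, h x := by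
    rw [← integral_const_mul]
    exact integral_mono (hg.norm.pow 2).integrable_unitAddTorus
      (hh.integrable_unitAddTorus.const_mul _) hle
  calc Real.sqrt (∫ x, ‖g x‖ ^ 2) ≤ Real.sqrt (K ^ 2 * ∫ x, h x) := Real.sqrt_le_sqrt h1
    _ = K * Real.sqrt (∫ x, h x) := by rw [Real.sqrt_mul (sq_nonneg K), Real.sqrt_sq hK]

/-- From a pointwise bound `‖g‖ ≤ K` (continuous `g`, `K ≥ 0`) to `(∫ ‖g‖²)^{1/2} ≤ K` on the
probability space `T³`. [folklore] -/
theorem nonresonantSelection_perturb_sqrt_integral_le_of_norm_le {G : Type*} [NormedAddCommGroup G]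
    {g : UnitAddTorus (Fin 3) → G} (hg : Continuous g) {K : ℝ} (hK : 0 ≤ K)
    (hle : ∀ x, ‖g x‖ ≤ K) : Real.sqrt (∫ x, ‖g x‖ ^ 2) ≤ K := by
  have h1 : ∫ x, ‖g x‖ ^ 2 ≤ ∫ _x : UnitAddTorus (Fin 3), K ^ 2 :=
    integral_mono (hg.norm.pow 2).integrable_unitAddTorus (integrable_const _)
      fun x => pow_le_pow_left₀ (norm_nonneg _) (hle x) 2
  rw [integral_const, probReal_univ, one_smul] at h1
  calc Real.sqrt (∫ x, ‖g x‖ ^ 2) ≤ Real.sqrt (K ^ 2) := Real.sqrt_le_sqrt h1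
    _ = K := Real.sqrt_sq hK

/-- Minkowski in `L²(T³)` for five continuous fields:
`‖F + A + B + C + D‖₂ ≤ ‖F‖₂ + ‖A‖₂ + ‖B‖₂ + ‖C‖₂ + ‖D‖₂` (iterate
`Torus.sqrt_integral_norm_add_sq_le`). [folklore] -/
theorem nonresonantSelection_perturb_sqrt_integral_add_five_le
    {F A B C D : UnitAddTorus (Fin 3) → EuclideanSpace ℝ (Fin 3)} (hF : Continuous F)
    (hA : Continuous A) (hB : Continuous B) (hC : Continuous C) (hD : Continuous D) :
    Real.sqrt (∫ x, ‖F x + A x + B x + C x + D x‖ ^ 2) ≤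
      Real.sqrt (∫ x, ‖F x‖ ^ 2) + Real.sqrt (∫ x, ‖A x‖ ^ 2) + Real.sqrt (∫ x, ‖B x‖ ^ 2) +
        Real.sqrt (∫ x, ‖C x‖ ^ 2) + Real.sqrt (∫ x, ‖D x‖ ^ 2) := by
  have h1 : Real.sqrt (∫ x, ‖F x + A x‖ ^ 2) ≤
      Real.sqrt (∫ x, ‖F x‖ ^ 2) + Real.sqrt (∫ x, ‖A x‖ ^ 2) :=
    Torus.sqrt_integral_norm_add_sq_le hF hA
  have h2 : Real.sqrt (∫ x, ‖F x + A x + B x‖ ^ 2) ≤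
      Real.sqrt (∫ x, ‖F x + A x‖ ^ 2) + Real.sqrt (∫ x, ‖B x‖ ^ 2) :=
    Torus.sqrt_integral_norm_add_sq_le (hF.add hA) hB
  have h3 : Real.sqrt (∫ x, ‖F x + A x + B x + C x‖ ^ 2) ≤
      Real.sqrt (∫ x, ‖F x + A x + B x‖ ^ 2) + Real.sqrt (∫ x, ‖C x‖ ^ 2) :=
    Torus.sqrt_integral_norm_add_sq_le ((hF.add hA).add hB) hC
  have h4 : Real.sqrt (∫ x, ‖F x + A x + B x + C x + D x‖ ^ 2) ≤
      Real.sqrt (∫ x, ‖F x + A x + B x + C x‖ ^ 2) + Real.sqrt (∫ x, ‖D x‖ ^ 2) :=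
    Torus.sqrt_integral_norm_add_sq_le (((hF.add hA).add hB).add hC) hD
  linarith

/-! ## The stub -/

/-- **Perturbation of the bordered residual** (stub `stub_residualPerturbation` of the line `birth`
of the crux `NeutralTaylorWaves.NonresonantSelection`, registered signature verbatim). For smooth
`w₁, w, v : T³ → ℝ³`, smooth `r`, reals `ν, c₁, c, b` and `δ ≥ 0` with `sup ‖w − w₁‖ ≤ δ`,
`sup ‖∂ᵢw − ∂ᵢw₁‖ ≤ δ`, `|c − c₁| ≤ δ`: the bordered residuals `F₁` (at `(w₁, c₁)`) and `F` (at
`(w, c)`) of the same test triple `(v, r, b)` satisfy `‖F₁‖₂ ≤ ‖F‖₂ + δ (2‖∇v‖₂ + 2‖v‖₂ + |b|)`,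
and `|∫⟪v, ∂₃w₁⟫ − ∫⟪v, ∂₃w⟫| ≤ δ ‖v‖₂`. [folklore] -/
theorem stub_residualPerturbation :
    ∀ (ν c₁ c b δ : ℝ) (w₁ w v : UnitAddTorus (Fin 3) → EuclideanSpace ℝ (Fin 3))
      (r : UnitAddTorus (Fin 3) → ℝ),
      Torus.IsSmooth w₁ → Torus.IsSmooth w → Torus.IsSmooth v → Torus.IsSmooth r → 0 ≤ δ →
      (∀ x, ‖w x - w₁ x‖ ≤ δ) →
      (∀ (i : Fin 3) x, ‖Torus.partialDeriv i w x - Torus.partialDeriv i w₁ x‖ ≤ δ) →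
      |c - c₁| ≤ δ →
      Real.sqrt (∫ x, ‖Torus.convect w₁ v x + Torus.convect v w₁ x - ν • Torus.laplacian v x +
            Torus.gradient r x - c₁ • Torus.partialDeriv (2 : Fin 3) v x -
            b • Torus.partialDeriv (2 : Fin 3) w₁ x‖ ^ 2) ≤
          Real.sqrt (∫ x, ‖Torus.convect w v x + Torus.convect v w x - ν • Torus.laplacian v x +
            Torus.gradient r x - c • Torus.partialDeriv (2 : Fin 3) v x -
            b • Torus.partialDeriv (2 : Fin 3) w x‖ ^ 2) +
          δ * (2 * Real.sqrt (Torus.gradNormSq v) + 2 * Real.sqrt (∫ x, ‖v x‖ ^ 2) + |b|) ∧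
        |(∫ x, inner ℝ (v x) (Torus.partialDeriv (2 : Fin 3) w₁ x)) -
            ∫ x, inner ℝ (v x) (Torus.partialDeriv (2 : Fin 3) w x)| ≤
          δ * Real.sqrt (∫ x, ‖v x‖ ^ 2) := by
  intro ν c₁ c b δ w₁ w v r hw₁ hw hv hr hδ h0 h1 hc
  have hw1 : Torus.IsContDiff 1 w := hw.isContDiff (by simp)
  have hw₁1 : Torus.IsContDiff 1 w₁ := hw₁.isContDiff (by simp)
  refine ⟨?_, ?_⟩
  · /- First conjunct: `F₁ = F + A + B + C + D` pointwise with
    `A = Dv[w₁ − w]`, `B = ∑ᵢ vᵢ (∂ᵢw₁ − ∂ᵢw)`, `C = (c − c₁) ∂₃v`, `D = b (∂₃w − ∂₃w₁)`. -/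
    have key : ∀ x, Torus.convect w₁ v x + Torus.convect v w₁ x - ν • Torus.laplacian v x +
          Torus.gradient r x - c₁ • Torus.partialDeriv (2 : Fin 3) v x -
          b • Torus.partialDeriv (2 : Fin 3) w₁ x =
        Torus.convect w v x + Torus.convect v w x - ν • Torus.laplacian v x +
          Torus.gradient r x - c • Torus.partialDeriv (2 : Fin 3) v x -
          b • Torus.partialDeriv (2 : Fin 3) w x +
          (Torus.convect w₁ v x - Torus.convect w v x) +
          (Torus.convect v w₁ x - Torus.convect v w x) +
          (c - c₁) • Torus.partialDeriv (2 : Fin 3) v x +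
          b • (Torus.partialDeriv (2 : Fin 3) w x - Torus.partialDeriv (2 : Fin 3) w₁ x) := by
      intro x
      simp only [sub_smul, smul_sub]
      abel
    -- continuity of the five fields
    have cF : Continuous fun x => Torus.convect w v x + Torus.convect v w x -
        ν • Torus.laplacian v x + Torus.gradient r x - c • Torus.partialDeriv (2 : Fin 3) v x -
        b • Torus.partialDeriv (2 : Fin 3) w x :=
      (((((hw.convect hv).continuous.add (hv.convect hw).continuous).sub
        (hv.laplacian.continuous.const_smul ν)).add hr.gradient.continuous).sub
        ((hv.partialDeriv 2).continuous.const_smul c)).sub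
        ((hw.partialDeriv 2).continuous.const_smul b)
    have cA : Continuous fun x => Torus.convect w₁ v x - Torus.convect w v x :=
      (hw₁.convect hv).continuous.sub (hw.convect hv).continuous
    have cB : Continuous fun x => Torus.convect v w₁ x - Torus.convect v w x :=
      (hv.convect hw₁).continuous.sub (hv.convect hw).continuous
    have cC : Continuous fun x => (c - c₁) • Torus.partialDeriv (2 : Fin 3) v x :=
      (hv.partialDeriv 2).continuous.const_smul (c - c₁)
    have cD : Continuous fun x =>
        b • (Torus.partialDeriv (2 : Fin 3) w x - Torus.partialDeriv (2 : Fin 3) w₁ x) :=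
      ((hw.partialDeriv 2).continuous.sub (hw₁.partialDeriv 2).continuous).const_smul b
    have cS : Continuous fun x => ∑ i, ‖Torus.partialDeriv i v x‖ ^ 2 :=
      continuous_finsetSum _ fun i _ => (hv.partialDeriv i).continuous.norm.pow 2
    -- pointwise bounds on the four perturbation terms
    have hApt : ∀ x, ‖Torus.convect w₁ v x - Torus.convect w v x‖ ^ 2 ≤
        δ ^ 2 * ∑ i, ‖Torus.partialDeriv i v x‖ ^ 2 := by
      intro x
      have e1 : Torus.convect w₁ v x - Torus.convect w v x = Torus.fderiv v x (w₁ x - w x) := by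
        simp only [Torus.convect, map_sub]
      have hS : 0 ≤ ∑ i, ‖Torus.partialDeriv i v x‖ ^ 2 :=
        Finset.sum_nonneg fun i _ => sq_nonneg _
      have hn : ‖Torus.convect w₁ v x - Torus.convect w v x‖ ≤
          δ * Real.sqrt (∑ i, ‖Torus.partialDeriv i v x‖ ^ 2) := by
        rw [e1]
        refine (nonresonantSelection_perturb_norm_fderiv_apply_le hv x _).trans ?_
        refine mul_le_mul_of_nonneg_right ?_ (Real.sqrt_nonneg _)
        rw [norm_sub_rev]
        exact h0 x
      calc ‖Torus.convect w₁ v x - Torus.convect w v x‖ ^ 2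
          ≤ (δ * Real.sqrt (∑ i, ‖Torus.partialDeriv i v x‖ ^ 2)) ^ 2 :=
            pow_le_pow_left₀ (norm_nonneg _) hn 2
        _ = δ ^ 2 * ∑ i, ‖Torus.partialDeriv i v x‖ ^ 2 := by rw [mul_pow, Real.sq_sqrt hS]
    have hBpt : ∀ x, ‖Torus.convect v w₁ x - Torus.convect v w x‖ ^ 2 ≤
        (2 * δ) ^ 2 * ‖v x‖ ^ 2 := by
      intro x
      have e1 : Torus.convect v w₁ x - Torus.convect v w x =
          ∑ i, v x i • (Torus.partialDeriv i w₁ x - Torus.partialDeriv i w x) := by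
        simp only [Torus.convect, Torus.fderiv_apply_eq_sum_partialDeriv hw₁1,
          Torus.fderiv_apply_eq_sum_partialDeriv hw1, smul_sub, Finset.sum_sub_distrib]
      have hn : ‖Torus.convect v w₁ x - Torus.convect v w x‖ ≤ 2 * δ * ‖v x‖ := by
        rw [e1]
        exact nonresonantSelection_perturb_norm_sum_smul_le (v x) _ hδ fun i => by
          rw [norm_sub_rev]
          exact h1 i x
      calc ‖Torus.convect v w₁ x - Torus.convect v w x‖ ^ 2 ≤ (2 * δ * ‖v x‖) ^ 2 :=
            pow_le_pow_left₀ (norm_nonneg _) hn 2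
        _ = (2 * δ) ^ 2 * ‖v x‖ ^ 2 := by ring
    have hCpt : ∀ x, ‖(c - c₁) • Torus.partialDeriv (2 : Fin 3) v x‖ ^ 2 ≤
        δ ^ 2 * ∑ i, ‖Torus.partialDeriv i v x‖ ^ 2 := by
      intro x
      have hle : ‖Torus.partialDeriv (2 : Fin 3) v x‖ ^ 2 ≤ ∑ i, ‖Torus.partialDeriv i v x‖ ^ 2 :=
        Finset.single_le_sum (f := fun i => ‖Torus.partialDeriv i v x‖ ^ 2)
          (fun i _ => sq_nonneg _) (Finset.mem_univ 2)
      rw [norm_smul, Real.norm_eq_abs, mul_pow]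
      exact mul_le_mul (pow_le_pow_left₀ (abs_nonneg _) hc 2) hle (sq_nonneg _) (sq_nonneg δ)
    have hDpt : ∀ x,
        ‖b • (Torus.partialDeriv (2 : Fin 3) w x - Torus.partialDeriv (2 : Fin 3) w₁ x)‖ ≤
          |b| * δ := by
      intro x
      rw [norm_smul, Real.norm_eq_abs]
      exact mul_le_mul_of_nonneg_left (h1 2 x) (abs_nonneg b)
    -- `L²` bounds on the four perturbation terms
    have hg : Torus.gradNormSq v = ∫ x, ∑ i, ‖Torus.partialDeriv i v x‖ ^ 2 := rfl
    have hA2 : Real.sqrt (∫ x, ‖Torus.convect w₁ v x - Torus.convect w v x‖ ^ 2) ≤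
        δ * Real.sqrt (Torus.gradNormSq v) := by
      rw [hg]
      exact nonresonantSelection_perturb_sqrt_integral_le cA cS hδ hApt
    have hB2 : Real.sqrt (∫ x, ‖Torus.convect v w₁ x - Torus.convect v w x‖ ^ 2) ≤
        2 * δ * Real.sqrt (∫ x, ‖v x‖ ^ 2) :=
      nonresonantSelection_perturb_sqrt_integral_le cB (hv.continuous.norm.pow 2)
        (mul_nonneg zero_le_two hδ) hBpt
    have hC2 : Real.sqrt (∫ x, ‖(c - c₁) • Torus.partialDeriv (2 : Fin 3) v x‖ ^ 2) ≤
        δ * Real.sqrt (Torus.gradNormSq v) := by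
      rw [hg]
      exact nonresonantSelection_perturb_sqrt_integral_le cC cS hδ hCpt
    have hD2 : Real.sqrt (∫ x,
        ‖b • (Torus.partialDeriv (2 : Fin 3) w x - Torus.partialDeriv (2 : Fin 3) w₁ x)‖ ^ 2) ≤
        |b| * δ :=
      nonresonantSelection_perturb_sqrt_integral_le_of_norm_le cD (mul_nonneg (abs_nonneg b) hδ)
        hDpt
    -- Minkowski
    have hM := nonresonantSelection_perturb_sqrt_integral_add_five_le cF cA cB cC cD
    simp_rw [key]
    linarith [hM, hA2, hB2, hC2, hD2]
  · /- Second conjunct: `∫⟪v, ∂₃w₁⟫ − ∫⟪v, ∂₃w⟫ = ∫⟪v, ∂₃w₁ − ∂₃w⟫`, then Cauchy–Schwarz. -/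
    have i1 : Integrable (fun x => ⟪v x, Torus.partialDeriv (2 : Fin 3) w₁ x⟫_ℝ) volume :=
      (hv.inner (hw₁.partialDeriv 2)).integrable
    have i2 : Integrable (fun x => ⟪v x, Torus.partialDeriv (2 : Fin 3) w x⟫_ℝ) volume :=
      (hv.inner (hw.partialDeriv 2)).integrable
    have cE : Continuous fun x =>
        Torus.partialDeriv (2 : Fin 3) w₁ x - Torus.partialDeriv (2 : Fin 3) w x :=
      (hw₁.partialDeriv 2).continuous.sub (hw.partialDeriv 2).continuous
    have hE2 : Real.sqrt (∫ x,
        ‖Torus.partialDeriv (2 : Fin 3) w₁ x - Torus.partialDeriv (2 : Fin 3) w x‖ ^ 2) ≤ δ :=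
      nonresonantSelection_perturb_sqrt_integral_le_of_norm_le cE hδ fun x => by
        rw [norm_sub_rev]
        exact h1 2 x
    rw [← integral_sub i1 i2]
    calc |∫ x, (⟪v x, Torus.partialDeriv (2 : Fin 3) w₁ x⟫_ℝ -
            ⟪v x, Torus.partialDeriv (2 : Fin 3) w x⟫_ℝ)|
        = |∫ x, ⟪v x, Torus.partialDeriv (2 : Fin 3) w₁ x - Torus.partialDeriv (2 : Fin 3) w x⟫_ℝ| := by
          simp only [inner_sub_right]
      _ ≤ ∫ x, |⟪v x, Torus.partialDeriv (2 : Fin 3) w₁ x - Torus.partialDeriv (2 : Fin 3) w x⟫_ℝ| :=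
          abs_integral_le_integral_abs
      _ ≤ ∫ x, ‖v x‖ * ‖Torus.partialDeriv (2 : Fin 3) w₁ x - Torus.partialDeriv (2 : Fin 3) w x‖ :=
          integral_mono (hv.continuous.inner cE).abs.integrable_unitAddTorus
            (hv.continuous.norm.mul cE.norm).integrable_unitAddTorus
            fun x => abs_real_inner_le_norm _ _
      _ ≤ Real.sqrt (∫ x, ‖v x‖ ^ 2) * Real.sqrt (∫ x,
            ‖Torus.partialDeriv (2 : Fin 3) w₁ x - Torus.partialDeriv (2 : Fin 3) w x‖ ^ 2) :=
          Torus.integral_mul_le_sqrt_mul_sqrt_of_continuous hv.continuous.norm cE.norm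
            (fun _ => norm_nonneg _) fun _ => norm_nonneg _
      _ ≤ Real.sqrt (∫ x, ‖v x‖ ^ 2) * δ :=
          mul_le_mul_of_nonneg_left hE2 (Real.sqrt_nonneg _)
      _ = δ * Real.sqrt (∫ x, ‖v x‖ ^ 2) := mul_comm _ _

end Summit.AnomalousDissipation.AnomalousDissipation.Theorems

end
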